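import Summits.Ventures.CertifiedManyBodySolver.Theorems.M3x2EdgeSplitSymReplaySU2Lower
import Summits.Ventures.CertifiedManyBodySolver.Theorems.M3x2EdgeSplitSymReplayDecodeV2
import HarnessLib

/-!
# SymReplay gramR / su2R — TEXT DECODERS over grammar v2 («ENC-2» letter codes, shared denominators, delta rows)
(hub-lb-sym-eng-3 g1, 2026-08-28; ADDITIVE shim joining `…GramRDecode` / `…SU2Lower` (pen hub-lb-sym-plan-1) with
`…DecodeV2` (pen hub-lb-dual-eng-3, landed by hub-lb-sym-eng-4, p639709); nothing of them is touched.)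

WHY.  The v0′ / E-class plans of record ship the ordinary certificate in grammar v2 (`decodeSymCertV2`) AND Gram data as
orbit-representative R-blocks (`gramR`, grouped shards) — the closing needs ONE decoder producing a `SymCertR` from a v2
certificate text plus an R-text; likewise `SymCertS` for su2R.  Two R/S-text grammars are accepted:
* v1 R-text (`…GramRDecode`: `rblock := p q nM moveⁿᴹ nS polyⁿˢ nR rowⁿᴿ`, sites spelled out) — `decodeSymCertRV2 ts tsR`,
  `decodeSymCertSV2 ts tsR tsS` (v2 certificate, v1 R/S texts: emitters migrate piecewise);
* v2 R-text (this file): `rblockV2 := p q  nM (k vx vy cp cq)ⁿᴹ  D nS polyDⁿˢ  nR rowDⁿᴿ` — representatives in v2 letter codes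
  over ONE shared denominator `D` (`rdPolysD` of `…DecodeV2`, `D ≤ 0` read as `1`), factor rows delta-coded (`rdRowsD`);
  `sblockV2 := nC (p q)ⁿᶜ  nM moveⁿᴹ  D nS polyDⁿˢ  nR rowDⁿᴿ`; texts `gramRV2 := n rblockV2ⁿ`, `gramSV2 := n sblockV2ⁿ`;
  decoders `decodeGramRV2 tab`, `decodeGramSV2 tab` (site table `tab := siteTab frame` of the decoded certificate),
  **`decodeSymCertRV2V2 ts tsR`**, **`decodeSymCertSV2V2 ts tsR tsS`**.
Every closing theorem (`energyDensity_ge_symValueR`, `energyDensity_ge_of_shardsRGV/RGB`, `…SU2Lower` via `.lower`) applies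
to the decoded value verbatim; a malformed text can only make the checker fail (same trust model as `…Decode`).
Kernel regressions: `toyRCert`'s first R-block written in v2 tokens (letter codes computed from `frame3`'s site table)
round-trips field by field (token count, scale, moves, rows exact; representative through the checker's zero test).  No summit or crux statement is proved here; no certificate is replayed; nothing here predicts superconductivity.
-/

namespace Summit.Ventures.CertifiedManyBodySolver.Theorems.SymReplay

open Literature.Probability.LatticeModels

section DecodeRV2

/-- **v2 certificate text + v1 R-text** → `SymCertR`. -/
def decodeSymCertRV2 (ts tsR : Toks) : SymCertR := { toSymCert := decodeSymCertV2 ts, gramR := decodeGramR tsR }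

/-- **v2 certificate text + v1 R-text + v1 S-text** → `SymCertS` (su2R; lower with `.lower`). -/
def decodeSymCertSV2 (ts tsR tsS : Toks) : SymCertS :=
  { toSymCert := decodeSymCertV2 ts, gramR := decodeGramR tsR, gramS := decodeGramS tsS }

/-- Read a v2 R-block `p q  nM moveⁿᴹ  D nS polyDⁿˢ  nR rowDⁿᴿ` (moves as in v1; representatives in letter codes over the
shared denominator `D`; rows delta-coded). -/
def rdRBlockV2 (tab : Array (ℤ × ℤ)) (ts : Toks) : GramBlockR × Toks :=
  let s := rdQ ts
  let cm := rdNat s.2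
  let m := rdMoves cm.1 cm.2
  let d := rdDen m.2
  let cb := rdNat d.2
  let b := rdPolysD tab d.1 cb.1 cb.2
  let cr := rdNat b.2
  let r := rdRowsD cr.1 cr.2
  (⟨s.1, m.1, b.1, r.1⟩, r.2)

/-- Read `n` v2 R-blocks. -/
def rdRBlocksV2 (tab : Array (ℤ × ℤ)) : ℕ → Toks → List GramBlockR × Toks
  | 0, ts => ([], ts)
  | n + 1, ts => let b := rdRBlockV2 tab ts; let r := rdRBlocksV2 tab n b.2; (b.1 :: r.1, r.2)

/-- Decode a v2 `gramR` text `n rblockV2ⁿ` against the site table `tab`. -/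
def decodeGramRV2 (tab : Array (ℤ × ℤ)) (ts : Toks) : List GramBlockR := let c := rdNat ts; (rdRBlocksV2 tab c.1 c.2).1

/-- Tokens left over after a v2 `gramR` text (a well-formed text leaves `0`). -/
def decodeGramRV2Rest (tab : Array (ℤ × ℤ)) (ts : Toks) : ℕ := let c := rdNat ts; (rdRBlocksV2 tab c.1 c.2).2.length

/-- Read a v2 S-block `nC (p q)ⁿᶜ  nM moveⁿᴹ  D nS polyDⁿˢ  nR rowDⁿᴿ`. -/
def rdSBlockV2 (tab : Array (ℤ × ℤ)) (ts : Toks) : GramBlockS × Toks :=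
  let cs := rdNat ts
  let sc := rdQs cs.1 cs.2
  let cm := rdNat sc.2
  let m := rdMoves cm.1 cm.2
  let d := rdDen m.2
  let cb := rdNat d.2
  let b := rdPolysD tab d.1 cb.1 cb.2
  let cr := rdNat b.2
  let r := rdRowsD cr.1 cr.2
  (⟨sc.1, m.1, b.1, r.1⟩, r.2)

/-- Read `n` v2 S-blocks. -/
def rdSBlocksV2 (tab : Array (ℤ × ℤ)) : ℕ → Toks → List GramBlockS × Toks
  | 0, ts => ([], ts)
  | n + 1, ts => let b := rdSBlockV2 tab ts; let r := rdSBlocksV2 tab n b.2; (b.1 :: r.1, r.2)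

/-- Decode a v2 `gramS` text `n sblockV2ⁿ`. -/
def decodeGramSV2 (tab : Array (ℤ × ℤ)) (ts : Toks) : List GramBlockS := let c := rdNat ts; (rdSBlocksV2 tab c.1 c.2).1

/-- Tokens left over after a v2 `gramS` text. -/
def decodeGramSV2Rest (tab : Array (ℤ × ℤ)) (ts : Toks) : ℕ := let c := rdNat ts; (rdSBlocksV2 tab c.1 c.2).2.length

/-- **v2 certificate text + v2 R-text** → `SymCertR` (the R-text's letter codes index the certificate's frame). -/
def decodeSymCertRV2V2 (ts tsR : Toks) : SymCertR :=
  let K := decodeSymCertV2 ts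
  { toSymCert := K, gramR := decodeGramRV2 (siteTab K.frame) tsR }

/-- **v2 certificate text + v2 R-text + v2 S-text** → `SymCertS`. -/
def decodeSymCertSV2V2 (ts tsR tsS : Toks) : SymCertS :=
  let K := decodeSymCertV2 ts
  let tab := siteTab K.frame
  { toSymCert := K, gramR := decodeGramRV2 tab tsR, gramS := decodeGramSV2 tab tsS }

/-! ### Kernel regressions (`decide +kernel`) -/

/-- v2 letter code of the site `(a, b)`, spin `s`, dagger bit `dg` in `frame3`'s site table (for the toy text below). -/
def code3 (a b : ℤ) (s dg : ℕ) : ℤ := ((4 * frame3.findIdx (siteEq (mkSite a b)) + 2 * s + dg : ℕ) : ℤ)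

/-- `toyRCert`'s first R-block in v2 tokens: scale `1/32`, its 8 moves, `D = 1`, ONE representative
`c_{0↑} − c_{e₁↑}` (two one-letter words in letter codes), one row `[(1, 0)]` (delta-coded `1 0`). -/
def toyRBlockV2Toks : Toks :=
  [1, 32, 8, 0, 0, 0, 1, 1, 7, 0, 0, -1, 1, 4, 0, 2, 1, 1, 3, 0, 2, -1, 1, 6, 2, 0, 1, 1, 1, 2, 0, -1, 1, 2, 2, 2, 1, 1,
    5, 2, 2, -1, 1, 1, 1, 2, 1, 1, code3 0 0 0 0, -1, 1, code3 1 0 0 0, 1, 1, 1, 0]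

/-- The v2 R-block text consumes all its tokens. -/
example : (rdRBlockV2 (siteTab frame3) toyRBlockV2Toks).2.length = 0 := by decide +kernel

/-- … decodes the scale, the move count and the factor rows of `toyRCert.gramR[0]` … -/
example : (rdRBlockV2 (siteTab frame3) toyRBlockV2Toks).1.scale = 1 / 32 ∧
    (rdRBlockV2 (siteTab frame3) toyRBlockV2Toks).1.moves.length = 8 ∧
    (rdRBlockV2 (siteTab frame3) toyRBlockV2Toks).1.rows = [[(1, 0)]] := by decide +kernel

/-- … and its representative `c_{0↑} − c_{e₁↑}` (compared through the checker's own zero test). -/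
example : ((rdRBlockV2 (siteTab frame3) toyRBlockV2Toks).1.reps.map fun q =>
    isZero (psub q [(1, [ann 0 0]), (-1, [ann e1 0])])) = [true] := by decide +kernel

end DecodeRV2

end Summit.Ventures.CertifiedManyBodySolver.Theorems.SymReplay
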